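import Summits.ResolutionOfSingularities.ResolutionOfSingularities.Theorems.DeltaCutSepCertificates4
import HarnessLib

/-!
# DeltaCutSepCertificates5 — decomp-res node «SepCut» (lens-6 g26, critic row 196 CLEARED +1), tree file 8/8 of the node

Content VERBATIM from the decomp-res lens-6 g26 node `HOME/decomp-res-lens-6/g26/SepCut.lean` (pin f15f025c; no
carry, imports the landed tree only); HOME = run/shared/lean/pub/decomp-res; critic row 196 CLEARED +1; landing plan
NEXT-g27.md fb3fac1c §4 + rider INBOX :1178 — provenance, critic text and the lens header in full in the first file
of the node, `DeltaCutSep`.  Namespace `…Theorems.DeltaCutClasses`; `--supports stmt-ResolutionOfSingularities-26971`.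

## This file

Continuation 5/5 of `DeltaCutSepCertificates` (same section of the node, cut at the 400-line cap): carries
`Cx_closure_not_prime`, `Cx_sepFrozen_certificate`.

[WRITER NOTE (decomp-res writer g12): file split only (tree files ≤ 400 lines); namespace, sections, section opens
and every declaration exactly as in the lens (the node's HOME-only dupNamespace-linter line is dropped; the two
namespace-level `open …TwistCutClasses` / `open …LightCutClasses` lines of the node are replayed); in the
CERTIFICATES files the lens's five `private` helpers (`mem_of_sMul_mem_cube`, `mul_mem_pow_add`,
`not_mem_span_of_eval`, `sMul_not_mem_sq_of_pderiv_eq_one`, and `one_not_mem_prime`) lose `private` because their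
users now sit in later parts of the split, and `one_not_mem_prime` — statement-identical to the LANDED
`one_not_mem_of_isPrime` of g25 `DeltaCutRunCertificates` (a `dedup.landed` restatement) — is DELETED and its 12
uses cite `one_not_mem_of_isPrime` (hence the extra import `DeltaCutRunCertificates`); likewise `mul_mem_pow_add` —
statement-identical to the LANDED `Rescue.BedZpeBinom4Centre.mul_mem_pow_add` of another hand (cone-free module;
pre-flight `dedup.landed`) — is DELETED, that module imported and `open … (mul_mem_pow_add)` replayed in each
certificates file so the 6 uses stand verbatim.]

(Sources: Hironaka1967 (characteristic polyhedra); CossartJannsenSaito2020 Def. 3.13 / Thm. 3.14, Ch. 8, Thm. 9.6;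
Hironaka1970 (near points / vertices); CossartPiltant2019 Prop. 2.6; CossartPiltant2008 §2; Giraud1975; Hironaka2005
(three key theorems: order under permissible blow-up); EGAIV4 §16–§17; StacksProject 0804 / 0BIQ / 031I; Matsumura1987 §28.)
-/

noncomputable section

open CategoryTheory CategoryTheory.Limits AlgebraicGeometry TopologicalSpace IsLocalRing
open Literature.AlgebraicGeometry.Resolution

universe u

open Summit.ResolutionOfSingularities.ResolutionOfSingularities.Theorems.Rescue.BedZpeBinom4Centre (mul_mem_pow_add)

namespace Summit.ResolutionOfSingularities.ResolutionOfSingularities.Theorems.DeltaCutClasses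

open Summit.ResolutionOfSingularities.ResolutionOfSingularities.Theorems.TwistCutClasses
open Summit.ResolutionOfSingularities.ResolutionOfSingularities.Theorems.LightCutClasses

section SepCertificates

open MvPolynomial
variable {K : Type*} [Field K]

/-- **C× — THE REDUCED CLOSURE OF bad₀ IS NOT REGULAR at the origin**: its ideal `P_u ⊓ P_w` (the radical ideal of the union of
the two axes) is NOT PRIME — `u·w ∈ P_u ⊓ P_w` while `u, w ∉ P_u ⊓ P_w` — so the local ring of `V(P_u ⊓ P_w)` at the origin (the
two non-members stay non-members of `P_u·𝒪`, `P_w·𝒪` after localising at `𝔫₀ ⊇ P_u + P_w`) is not a domain, hence not regular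
(dictionary (R)).  The separating run is therefore INACTIVE at level 0 with bad₀ ≠ ∅: `SepFrozen` at height 0. [new;
elementary] [folklore] -/
theorem Cx_closure_not_prime :
    (X 2 * X 3 : MvPolynomial (Fin 4) K) ∈
        Ideal.span {(X 0 : MvPolynomial (Fin 4) K), X 1, X 3} ⊓ Ideal.span {(X 0 : MvPolynomial (Fin 4) K), X 1, X 2} ∧
      (X 2 : MvPolynomial (Fin 4) K) ∉
        Ideal.span {(X 0 : MvPolynomial (Fin 4) K), X 1, X 3} ⊓ Ideal.span {(X 0 : MvPolynomial (Fin 4) K), X 1, X 2} ∧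
      (X 3 : MvPolynomial (Fin 4) K) ∉
        Ideal.span {(X 0 : MvPolynomial (Fin 4) K), X 1, X 3} ⊓ Ideal.span {(X 0 : MvPolynomial (Fin 4) K), X 1, X 2} := by
  have hu3 : (X 3 : MvPolynomial (Fin 4) K) ∈ Ideal.span {(X 0 : MvPolynomial (Fin 4) K), X 1, X 3} := Ideal.subset_span (by simp)
  have hw2 : (X 2 : MvPolynomial (Fin 4) K) ∈ Ideal.span {(X 0 : MvPolynomial (Fin 4) K), X 1, X 2} := Ideal.subset_span (by simp)
  refine ⟨Ideal.mem_inf.2 ⟨Ideal.mul_mem_left _ _ hu3, Ideal.mul_mem_right _ _ hw2⟩, fun h2 => ?_, fun h3 => ?_⟩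
  · refine not_mem_span_of_eval _ (fun i => if i = 2 then 1 else 0) ?_ (by simp) (Ideal.mem_inf.1 h2).1
    intro g hg
    simp only [Set.mem_insert_iff, Set.mem_singleton_iff] at hg
    rcases hg with rfl | rfl | rfl <;> simp
  · refine not_mem_span_of_eval _ (fun i => if i = 3 then 1 else 0) ?_ (by simp) (Ideal.mem_inf.1 h3).2
    intro g hg
    simp only [Set.mem_insert_iff, Set.mem_singleton_iff] at hg
    rcases hg with rfl | rfl | rfl <;> simp

/-- **C× — THE FROZEN CERTIFICATE (`SepFrozen 3 (𝔸⁴, (C×))` at height 0; kind F INHABITED).**  (T) top locus =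
`u`-axis ∪ `w`-axis
(`Cx_top`, `Cx_axes`), (W)+(N) every closed point of both axes is WILD and δ-HEAVY (bad₀ = all closed points of the two axes:
NONEMPTY — and INFINITE: g25 kind A at level 0), (F) the reduced closure `V(P_u ⊓ P_w)` of bad₀ is NOT REGULAR at the origin
(`Cx_closure_not_prime`): the step-1 regularity test FAILS at the first level — `SepFrozen` with the empty active
prefix. [new] [folklore] -/
theorem Cx_sepFrozen_certificate [CharP K 3] :
    (∀ (𝔮 : Ideal (MvPolynomial (Fin 4) K)) [𝔮.IsPrime], ∀ s ∉ 𝔮,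
        s * (X 0 ^ 3 + X 1 ^ 4 + X 2 ^ 4 * X 3 ^ 4 : MvPolynomial (Fin 4) K) ∈ 𝔮 ^ 3 →
          (X 0 : MvPolynomial (Fin 4) K) ∈ 𝔮 ∧ (X 1 : MvPolynomial (Fin 4) K) ∈ 𝔮 ∧
            ((X 2 : MvPolynomial (Fin 4) K) ∈ 𝔮 ∨ (X 3 : MvPolynomial (Fin 4) K) ∈ 𝔮)) ∧
      (((X 0 ^ 3 + X 1 ^ 4 + X 2 ^ 4 * X 3 ^ 4 : MvPolynomial (Fin 4) K) ∈ (Ideal.span {(X 0 : MvPolynomial (Fin 4) K), X 1, X 3}) ^ 3 ∧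
          (X 0 ^ 3 + X 1 ^ 4 + X 2 ^ 4 * X 3 ^ 4 : MvPolynomial (Fin 4) K) ∈
            (Ideal.span {(X 0 : MvPolynomial (Fin 4) K), X 1, X 2}) ^ 3) ∧
        ((X 2 : MvPolynomial (Fin 4) K) ∉ Ideal.span {(X 0 : MvPolynomial (Fin 4) K), X 1, X 3} ∧
          (X 3 : MvPolynomial (Fin 4) K) ∉ Ideal.span {(X 0 : MvPolynomial (Fin 4) K), X 1, X 2}) ∧
        ((X 1 ^ 4 + X 2 ^ 4 * X 3 ^ 4 : MvPolynomial (Fin 4) K) ∈ (Ideal.span {(X 0 : MvPolynomial (Fin 4) K), X 1, X 3}) ^ 4 ∧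
          (X 1 ^ 4 + X 2 ^ 4 * X 3 ^ 4 : MvPolynomial (Fin 4) K) ∈ (Ideal.span {(X 0 : MvPolynomial (Fin 4) K), X 1, X 2}) ^ 4) ∧
        ((∀ H : MvPolynomial (Fin 4) K, (X 0 ^ 3 + X 2 * (X 1 ^ 4 + H * X 3 ^ 4) : MvPolynomial (Fin 4) K) ∈
            (Ideal.span {(X 0 : MvPolynomial (Fin 4) K), X 1, X 2, X 3}) ^ 3) ∧
          ∀ H : MvPolynomial (Fin 4) K, (X 0 ^ 3 + X 3 * (X 1 ^ 4 + H * X 2 ^ 4) : MvPolynomial (Fin 4) K) ∈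
            (Ideal.span {(X 0 : MvPolynomial (Fin 4) K), X 1, X 2, X 3}) ^ 3)) ∧
      ((X 2 * X 3 : MvPolynomial (Fin 4) K) ∈
          Ideal.span {(X 0 : MvPolynomial (Fin 4) K), X 1, X 3} ⊓ Ideal.span {(X 0 : MvPolynomial (Fin 4) K), X 1, X 2} ∧
        (X 2 : MvPolynomial (Fin 4) K) ∉
          Ideal.span {(X 0 : MvPolynomial (Fin 4) K), X 1, X 3} ⊓ Ideal.span {(X 0 : MvPolynomial (Fin 4) K), X 1, X 2} ∧
        (X 3 : MvPolynomial (Fin 4) K) ∉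
          Ideal.span {(X 0 : MvPolynomial (Fin 4) K), X 1, X 3} ⊓ Ideal.span {(X 0 : MvPolynomial (Fin 4) K), X 1, X 2}) :=
  ⟨fun 𝔮 _ _ hs h => Cx_top 𝔮 hs h, Cx_axes, Cx_closure_not_prime⟩

end SepCertificates

end Summit.ResolutionOfSingularities.ResolutionOfSingularities.Theorems.DeltaCutClasses
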